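import Summits.KontsevichZagierPeriods.KontsevichZagierPeriods.Theses.HodgeColevel
import Summits.KontsevichZagierPeriods.KontsevichZagierPeriods.Theorems.HodgeColevelCoresOfSummit
import Literature.NumberTheory.Transcendental.KZCalculusProofs
import Literature.NumberTheory.Transcendental.KZLogCalculusProofs
import Literature.NumberTheory.Transcendental.KZKernelConjectureForms

/-!
# KontsevichZagierPeriods / HodgeColevel — the strength of the crux `DegreeCompression`
# (item stmt-KontsevichZagierPeriods-6177; support file, lands `--supports`)

The crux `DegreeCompression` of route HodgeColevel ("equal values of KZ-rational representations ⇒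
the same dimensions are reachable by moves", OPEN CORE 1 of the route) is NOT strictly weaker than
the summit: it is EQUIVALENT to `KontsevichZagierPeriods` (`degreeCompression_iff_kontsevichZagierPeriods`,
sorry-free), and so is the first stub `stub_pointAccess` of the crux's registered line
`Cruxes/DegreeCompression/Lines/birth.lean` (`pointAccess_iff_kontsevichZagierPeriods`). Consequences
recorded for the route: `DegreeCompression → SameDegreeConjecture` (the second core is implied by the
first) and `Target ↔ KontsevichZagierPeriods`.

## The argument (zero edge + merging)

* §1 `of_mem_relations_of_dimZero`: a `0`-dimensional representation of the number `0` is a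
  relation. Its domain is `∅` or the one point `ℝ⁰`; in the second case the value is the integrand at
  that point, so the integrand vanishes on the domain either way, and rule (1b) for `f = f + f` gives
  `−[s] ∈ relations`.
* §2 `kzPeriodConjecture'_of_zeroAccess`: if every representation of value `0` MOVES TO A POINT, then
  Conjecture 1 holds — merge `r` and `−r'` into one representation `R`
  (`KZ.IntegralRep.exists_of_add_of_sub_of_mem_relations`: slabs at two levels of a new coordinate,
  domain additivity); `R` has value `0` by soundness, moves to a point `s` of value `0`, `[s]` is a
  relation by §1, hence so are `[R]` and `[r] − [r'] = ([r] + [−r'] − [R]) + [R] − ([r'] + [−r'])`.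
  The KZ-rational form follows by the rational lift `KZ.exists_isRational_equivalent_holds`.
* §3 the route's statements: `stub_pointAccess` (verbatim signature) asks exactly zero access for
  rational representations of value `0` (witness: the empty point representation, value `0`), so it
  implies the summit; `DegreeCompression` gives `stub_pointAccess` (compare with the rational lift of
  the `0`-dimensional witness at `k = 0`), so it implies the summit; the converses are the landed
  `coresOfSummit_proof` / the semialgebraic two-representation form `kzPeriodConjecture'_iff_isRational`.

Strategist r1 of crux stmt-KontsevichZagierPeriods-6177 (second opinion after the s2 census): the
typed half of `Cruxes/DegreeCompression/STRATEGY-CENSUS.md`. No definitions are introduced; no attack on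
Conjecture 1 itself is made here.

Sources: M. Kontsevich, D. Zagier, *Periods* (2001), §1.1 (Definition, `ℝ⁰` base case), §1.2
(rules (1)–(3), Conjecture 1); A. Huber, S. Müller-Stach, *Periods and Nori Motives* (2017), §13.1.
-/

noncomputable section

open MeasureTheory Set
open Literature.NumberTheory.Transcendental
open Summit.KontsevichZagierPeriods.KontsevichZagierPeriods.Theses.HodgeColevel
  (DegreeCompression SameDegreeConjecture Target CoresOfSummit)

namespace Summit.KontsevichZagierPeriods.HodgeColevel.DegreeCompressionStrength

variable {n m : ℕ}

/-! ## §1 Dimension zero: a point representation of the number `0` is a relation -/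

/-- The integrand of a `0`-dimensional representation of value `0` vanishes on its domain: a non-empty
domain is the one point `univ`, where the value IS the integrand. [Kontsevich–Zagier 2001, §1.1] [folklore] -/
theorem integrand_eq_zero_of_dimZero (s : KZ.IntegralRep 0) (hs : s.value = 0) :
    ∀ x ∈ s.domain, s.integrand x = 0 := by
  intro x hx
  have hdom : s.domain = univ := Subsingleton.eq_univ_of_nonempty ⟨x, hx⟩
  have hval : s.value = s.integrand x := by
    have h1 : s.value = ∫ _ in s.domain, s.integrand x :=
      setIntegral_congr_fun (KZ.IntegralRep.measurableSet_domain_holds s)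
        (fun y _ => congrArg s.integrand (Subsingleton.elim y x))
    -- Lebesgue measure of the one-point space `ℝ⁰` is `1` (the tree's
    -- `KZ.volume_univ_fin_zero`, inlined to keep the imports light)
    have hvol : volume (univ : Set (Fin 0 → ℝ)) = 1 := by
      rw [volume_pi, Measure.pi_univ]
      simp
    rw [h1, hdom, setIntegral_const]
    simp [Measure.real, hvol]
  rw [← hval, hs]

/-- **Zero edge in dimension `0`.** A `0`-dimensional representation `s` of the number `0` is
null-equivalent, `[s] ∈ KZ.relations`: its integrand vanishes on its domain
(`integrand_eq_zero_of_dimZero`), so additivity in the integrand (rule (1b)) for `f = f + f` reads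
`[s] − [s] − [s] ∈ relations`, i.e. `−[s] ∈ relations`.
[Kontsevich–Zagier 2001, §1.2, rule (1)] [cite: KontsevichZagier2001, §1.2 rule (1)] -/
theorem of_mem_relations_of_dimZero (s : KZ.IntegralRep 0) (hs : s.value = 0) :
    KZ.of s ∈ KZ.relations := by
  have h0 := integrand_eq_zero_of_dimZero s hs
  have h : KZ.of s - KZ.of s - KZ.of s ∈ KZ.integrandAddRel :=
    ⟨0, s, s, s, rfl, rfl, fun x hx => by simp [Pi.add_apply, h0 x hx], rfl⟩
  have := KZ.relations.neg_mem (KZ.integrandAddRel_subset_relations h)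
  simpa using this

/-- A `0`-dimensional representation of value `0` is KZ-equivalent to every null representation, e.g.
to the empty point representation. [Kontsevich–Zagier 2001, §1.2] [folklore] -/
theorem equivalent_empty_of_dimZero (s : KZ.IntegralRep 0) (hs : s.value = 0) :
    KZ.Equivalent s (KZ.IntegralRep.empty 0) :=
  KZ.relations.sub_mem (of_mem_relations_of_dimZero s hs) KZ.IntegralRep.of_empty_mem_relations

/-! ## §2 Moving the number `0` to a point is already Conjecture 1 -/

/-- **Zero access ⇒ Conjecture 1** (semialgebraic two-representation form `KZPeriodConjecture'`). If
every integral representation OF VALUE `0` is KZ-equivalent to some `0`-dimensional representation,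
then any two representations with the same value are KZ-equivalent. Proof: merge `r` and `−r'` into
one representation `R` (`KZ.IntegralRep.exists_of_add_of_sub_of_mem_relations`), of value `0` by
soundness (`KZ.relations_le_ker_eval_holds`); `R` moves to a point `s`, of value `0` by soundness, and
`[s]` is a relation (`of_mem_relations_of_dimZero`); hence `[R]` is a relation and so is
`[r] − [r'] = ([r] + [−r'] − [R]) + [R] − ([r'] + [−r'])` (`KZ.of_add_of_mem_relations_of_eqOn_neg`).
[Kontsevich–Zagier 2001, §1.2 Conjecture 1] [folklore] -/
theorem kzPeriodConjecture'_of_zeroAccess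
    (h : ∀ (N : ℕ) (R : KZ.IntegralRep N), R.value = 0 → ∃ s : KZ.IntegralRep 0, KZ.Equivalent R s) :
    KZPeriodConjecture' := by
  intro n m r r' hv
  obtain ⟨N, R, hR⟩ := KZ.IntegralRep.exists_of_add_of_sub_of_mem_relations r r'.neg
  have hneg : KZ.of r' + KZ.of r'.neg ∈ KZ.relations :=
    KZ.of_add_of_mem_relations_of_eqOn_neg (r := r') (r' := r'.neg) rfl fun _ _ => rfl
  have hval : R.value = 0 := by
    have hk := KZ.relations_le_ker_eval_holds hR
    rw [AddMonoidHom.mem_ker, map_sub, map_add, KZ.eval_of, KZ.eval_of, KZ.eval_of,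
      KZ.IntegralRep.value_neg, hv] at hk
    linarith
  obtain ⟨s, hs⟩ := h N R hval
  have hs0 : s.value = 0 := (KZ.Equivalent.value_eq_holds hs).symm.trans hval
  have hR0 : KZ.of R ∈ KZ.relations := by
    have := KZ.relations.add_mem hs (of_mem_relations_of_dimZero s hs0)
    simpa [KZ.Equivalent] using this
  have : KZ.of r - KZ.of r' =
      (KZ.of r + KZ.of r'.neg - KZ.of R) + KZ.of R - (KZ.of r' + KZ.of r'.neg) := by abel
  rw [show KZ.Equivalent r r' ↔ KZ.of r - KZ.of r' ∈ KZ.relations from Iff.rfl, this]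
  exact KZ.relations.sub_mem (KZ.relations.add_mem hR hR0) hneg

/-- The same from zero access for KZ-RATIONAL representations only (rational lift
`KZ.exists_isRational_equivalent_holds` of the merged representation first).
[Kontsevich–Zagier 2001, §1.1 remark after the Definition, §1.2 Conjecture 1] [folklore] -/
theorem kzPeriodConjecture'_of_zeroAccess_isRational
    (h : ∀ (N : ℕ) (R : KZ.IntegralRep N), R.IsRational → R.value = 0 →
      ∃ s : KZ.IntegralRep 0, KZ.Equivalent R s) :
    KZPeriodConjecture' := by
  refine kzPeriodConjecture'_of_zeroAccess fun N R hR0 => ?_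
  obtain ⟨M, Q, hQ, hRQ⟩ := KZ.exists_isRational_equivalent_holds R
  have hQ0 : Q.value = 0 := (KZ.Equivalent.value_eq_holds hRQ).symm.trans hR0
  obtain ⟨s, hs⟩ := h M Q hQ hQ0
  exact ⟨s, hRQ.trans hs⟩

/-- Conversely Conjecture 1 gives zero access (compare with the empty point representation), so
**zero access ⟺ `KZPeriodConjecture'`**. [Kontsevich–Zagier 2001, §1.2 Conjecture 1] [folklore] -/
theorem kzPeriodConjecture'_iff_zeroAccess :
    KZPeriodConjecture' ↔
      ∀ (N : ℕ) (R : KZ.IntegralRep N), R.value = 0 → ∃ s : KZ.IntegralRep 0, KZ.Equivalent R s :=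
  ⟨fun H N R hR0 => ⟨KZ.IntegralRep.empty 0, H R _ (by rw [KZ.IntegralRep.value_empty, hR0])⟩,
    kzPeriodConjecture'_of_zeroAccess⟩

/-! ## §3 Consequences for route HodgeColevel -/

/-- The empty representation has KZ's literal rational shape (vacuously: `0 / 1` on `∅`).
[Kontsevich–Zagier 2001, §1.1] [folklore] -/
theorem isRational_empty (k : ℕ) : (KZ.IntegralRep.empty k).IsRational :=
  ⟨0, 1, fun _ hx => hx.elim, fun _ hx => hx.elim⟩

/-- **The registered line's first stub is the summit.** The signature of `stub_pointAccess` of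
`Cruxes/DegreeCompression/Lines/birth.lean`, verbatim (a KZ-rational representation whose value is the
value of some `0`-dimensional representation moves to a point), implies `KontsevichZagierPeriods`:
applied to rational representations of value `0` (witness `KZ.IntegralRep.empty 0`) it is zero access,
`kzPeriodConjecture'_of_zeroAccess_isRational`, and the semialgebraic form gives the literal one
(`kzPeriodConjecture'_iff_isRational`). [Kontsevich–Zagier 2001, §1.2 Conjecture 1] [folklore] -/
theorem kontsevichZagierPeriods_of_pointAccess
    (h0 : ∀ (n : ℕ) (r : KZ.IntegralRep n), r.IsRational →
      (∃ u : KZ.IntegralRep 0, u.value = r.value) → ∃ s : KZ.IntegralRep 0, KZ.Equivalent r s) :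
    KontsevichZagierPeriods :=
  kzPeriodConjecture'_iff_isRational.mp <|
    kzPeriodConjecture'_of_zeroAccess_isRational fun N R hR hR0 =>
      h0 N R hR ⟨KZ.IntegralRep.empty 0, by rw [KZ.IntegralRep.value_empty, hR0]⟩

/-- **`stub_pointAccess` ⟺ summit**: the converse is the semialgebraic two-representation form of
Conjecture 1 (`r ~ u` outright). So the line `birth` is not a weakening: its `k = 0` stub alone is
`KontsevichZagierPeriods`. [Kontsevich–Zagier 2001, §1.2 Conjecture 1] [folklore] -/
theorem pointAccess_iff_kontsevichZagierPeriods :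
    (∀ (n : ℕ) (r : KZ.IntegralRep n), r.IsRational →
      (∃ u : KZ.IntegralRep 0, u.value = r.value) → ∃ s : KZ.IntegralRep 0, KZ.Equivalent r s) ↔
      KontsevichZagierPeriods := by
  refine ⟨kontsevichZagierPeriods_of_pointAccess, fun H n r _ hu => ?_⟩
  obtain ⟨u, hu⟩ := hu
  have H' : KZPeriodConjecture' := kzPeriodConjecture'_iff_isRational.mpr H
  exact ⟨u, H' r u hu.symm⟩

/-- `DegreeCompression` gives point access (the census's `Access` at `k = 0`): compare `r` with the
rational lift `Q` of the `0`-dimensional witness `u` (`KZ.exists_isRational_equivalent_holds`), which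
reaches dimension `0` through `u`. [Kontsevich–Zagier 2001, §1.2 Conjecture 1] [folklore] -/
theorem pointAccess_of_degreeCompression (hC : DegreeCompression) :
    ∀ (n : ℕ) (r : KZ.IntegralRep n), r.IsRational →
      (∃ u : KZ.IntegralRep 0, u.value = r.value) → ∃ s : KZ.IntegralRep 0, KZ.Equivalent r s := by
  intro n r hr hu
  obtain ⟨u, hu⟩ := hu
  obtain ⟨M, Q, hQ, huQ⟩ := KZ.exists_isRational_equivalent_holds u
  have hv : Q.value = r.value := ((KZ.Equivalent.value_eq_holds huQ).symm).trans hu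
  exact hC Q r hQ hr hv 0 ⟨u, huQ.symm⟩

/-- **The crux implies the summit**: `DegreeCompression → KontsevichZagierPeriods`.
[Kontsevich–Zagier 2001, §1.2 Conjecture 1] [folklore] -/
theorem kontsevichZagierPeriods_of_degreeCompression (hC : DegreeCompression) :
    KontsevichZagierPeriods :=
  kontsevichZagierPeriods_of_pointAccess (pointAccess_of_degreeCompression hC)

/-- **The crux IS the summit**: `DegreeCompression ↔ KontsevichZagierPeriods` (converse: the landed
honesty certificate `coresOfSummit_proof`). The route's split `DegreeCompression ∧ SameDegreeConjecture`
therefore has a piece equivalent to the whole conjecture; `DegreeCompression` is summit-strength by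
theorem, not only by reputation. [Kontsevich–Zagier 2001, §1.2 Conjecture 1] [folklore] -/
theorem degreeCompression_iff_kontsevichZagierPeriods : DegreeCompression ↔ KontsevichZagierPeriods :=
  ⟨kontsevichZagierPeriods_of_degreeCompression,
    fun h => (Summit.KontsevichZagierPeriods.HodgeColevel.coresOfSummit_proof h).1⟩

/-- The first open core implies the second: `DegreeCompression → SameDegreeConjecture`.
[Kontsevich–Zagier 2001, §1.2 Conjecture 1] [folklore] -/
theorem sameDegreeConjecture_of_degreeCompression (hC : DegreeCompression) : SameDegreeConjecture :=
  (Summit.KontsevichZagierPeriods.HodgeColevel.coresOfSummit_proof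
    (kontsevichZagierPeriods_of_degreeCompression hC)).2

/-- The route's target `X = DegreeCompression ∧ SameDegreeConjecture` is equivalent to the summit, and
already its first conjunct is. [Kontsevich–Zagier 2001, §1.2 Conjecture 1] [folklore] -/
theorem target_iff_kontsevichZagierPeriods : Target ↔ KontsevichZagierPeriods :=
  ⟨fun h => kontsevichZagierPeriods_of_degreeCompression h.1,
    fun h => Summit.KontsevichZagierPeriods.HodgeColevel.coresOfSummit_proof h⟩

end Summit.KontsevichZagierPeriods.HodgeColevel.DegreeCompressionStrength

end
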